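import Mathlib.Analysis.Complex.Polynomial.Basic
import Mathlib.Topology.Algebra.Support
import Literature.NumberTheory.Automorphic.MatrixCoefficientsProofs
import Literature.NumberTheory.Automorphic.SmoothRepresentationIrreducibleContragredientProofs
import Literature.NumberTheory.Automorphic.RestrictedTensorProductIrreducibleProofs
import HarnessLib

/-!
# Invariant sesquilinear forms on admissible irreducible representations: Riesz and Schur

Topic `NumberTheory/Automorphic` (declarations in Mathlib's `Representation` namespace, as deliberate
dot-notation extensions next to ★ `Representation.IsSmooth` / `IsAdmissible` / `IsSupercuspidal` /
`contragredient`; theorems only — no definition, instance, notation or named fact).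

Let `G` be a locally profinite group (`[NonarchimedeanGroup G] [LocallyCompactSpace G] [T2Space G]`),
`ρ : Representation ℂ G V` IRREDUCIBLE and ADMISSIBLE, and `B : V →ₗ⋆[ℂ] V →ₗ[ℂ] ℂ` a `G`-INVARIANT
sesquilinear form (`B (ρ g v) (ρ g w) = B v w`, conjugate-linear in the first slot — Mathlib's inner
product convention, as in ★ `Representation.IsUnitarizable`) which is DEFINITE (`B u u = 0 → u = 0`;
e.g. positive definite). This file proves the two algebraic facts on which the Schur orthogonality
relations for supercuspidal representations (`Literature.NumberTheory.Automorphic.SchurOrthogonalitySupercuspidal`)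
rest — Laumon 1996, Appendix D, Lemma (D.6.3) (i), (ii), here for IRREDUCIBLE admissible `ρ`:

* `Representation.exists_sesqForm_apply_eq_of_mem_contragredient` (**Riesz**, (D.6.3) (i)): every smooth linear
  form `f ∈ Ṽ` is `B v` for a unique `v` — i.e. `v ↦ B v` is a conjugate-linear `G`-isomorphism
  `V ≃ Ṽ` onto the smooth contragredient. Proof: `{B v : v ∈ V}` is a non-zero subrepresentation of
  `Ṽ`, and `Ṽ` is irreducible (★ `Representation.isIrreducible_contragredient_holds`,
  Bernstein–Zelevinsky 1976, Prop. 2.15).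
* `Representation.exists_sesqForm_eq_smul` (**Schur's lemma for forms**, (D.6.3) (ii) in the slightly
  wider form «ANY invariant sesquilinear `T` — Hermitian or not — is `c₀ • B`»). Proof: by Riesz `T c = B (A c)` with `A : V → V` linear
  and `G`-equivariant, so `A` is a scalar by Schur's lemma for admissible irreducible representations
  (★ `Representation.IsAdmissible.exists_eq_smul_id`, Bump 1997, Prop. 4.2.4).

and records the elementary analysis of the coefficient functions `x ↦ B w (ρ x v)` (= the matrix
coefficient `c_{B w, v}`, ★ `Representation.matrixCoeff`) and `x ↦ B (ρ x v) w`: continuity for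
smooth `v` (★ `Representation.continuous_matrixCoeff`) and COMPACT SUPPORT when `ρ` is supercuspidal
(★ `Representation.IsSupercuspidal`: smooth coefficients supported in `C · Z(G)`, `C` compact) and the
centre `Z(G)` is compact — the situation of `U(3)` over a `p`-adic field (Rogawski 1990, §12.6,
p. 187: "`f_π` a matrix coefficient if `π` is supercuspidal"), where no passage to `G / Z` is needed.

## References

* G. Laumon, *Cohomology of Drinfeld modular varieties*, Part I, Cambridge Stud. Adv. Math. 41
  (1996), Appendix D, (D.6): Lemma (D.6.3) (i) (invariant definite Hermitian products ↔ isomorphisms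
  `V ≃ V* = conj Ṽ`), (ii) (proportionality on irreducibles), Lemma (D.6.4). [Laumon1995]
* Harish-Chandra (notes by G. van Dijk), *Harmonic analysis on reductive `p`-adic groups*, LNM 162
  (1970), Part I §1 (Theorem 1, Schur orthogonality relations) and §3 (supercusp forms).
  [HarishChandra1970]
* C. J. Bushnell, G. Henniart, *The local Langlands conjecture for `GL(2)`* (2006), §2.8–2.10
  (contragredient, `Ṽ` of an admissible irreducible), §10.1–10.2. [BushnellHenniart2006]
* D. Bump, *Automorphic forms and representations* (1997), §4.2 (Prop. 4.2.4, Schur's lemma;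
  Exercise 4.2.8, irreducibility of the contragredient). [Bump1997]
-/

noncomputable section

open scoped ComplexConjugate

namespace Representation

open Literature.NumberTheory.Automorphic

section Algebra

variable {G V : Type*} [Group G] [TopologicalSpace G] [AddCommGroup V] [Module ℂ V]
  {ρ : Representation ℂ G V}

/-- For a `G`-invariant sesquilinear form `T` on a smooth representation (`T (ρ g v) (ρ g w) = T v w`),
every partial functional `T c : V →ₗ[ℂ] ℂ` is a smooth linear form, i.e. lies in the contragredient
`Ṽ`: its stabiliser under the dual action contains the (open) stabiliser of `c`. [cite: Laumon1995, (D.6), proof of Lemma (D.6.3) (the morphism ι : V → V*)] -/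
theorem sesqForm_apply_mem_contragredient [SeparatelyContinuousMul G] (hsm : ρ.IsSmooth)
    (T : V →ₗ⋆[ℂ] V →ₗ[ℂ] ℂ) (hT : ∀ (g : G) (v w : V), T (ρ g v) (ρ g w) = T v w) (c : V) :
    (T c : Module.Dual ℂ V) ∈ ρ.contragredient := by
  rw [mem_contragredient]
  refine ρ.dual.isSmoothVector_of_le (hsm c) fun g hg => ?_
  rw [mem_stabilizerSubgroup] at hg ⊢
  refine LinearMap.ext fun a => ?_
  simp only [dual_apply, Module.Dual.transpose_apply, LinearMap.comp_apply]
  calc T c (ρ g⁻¹ a) = T (ρ g c) (ρ g (ρ g⁻¹ a)) := (hT g _ _).symm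
    _ = T c a := by rw [hg, self_inv_apply]

/-- A definite sesquilinear form separates: `B v = B w` (as linear functionals) forces `v = w`, when
`B u u = 0` only for `u = 0`. [cite: Laumon1995, (D.6), proof of Lemma (D.6.3) («obviously, it is a monomorphism»)] -/
theorem eq_of_sesqForm_apply_eq {B : V →ₗ⋆[ℂ] V →ₗ[ℂ] ℂ} (hBdef : ∀ u : V, B u u = 0 → u = 0)
    {v w : V} (h : B v = B w) : v = w := by
  rw [← sub_eq_zero]
  apply hBdef
  rw [show B (v - w) = 0 by rw [map_sub, h, sub_self], LinearMap.zero_apply]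

/-- A definite Hermitian form has `B u u = 0` only at `u = 0` (from `0 < re (B u u)` for `u ≠ 0`).
[cite: Laumon1995, (D.6), definition (positive definite ⇒ definite)] -/
theorem eq_zero_of_sesqForm_self_eq_zero {B : V →ₗ⋆[ℂ] V →ₗ[ℂ] ℂ}
    (hBpos : ∀ v : V, v ≠ 0 → 0 < (B v v).re) (u : V) (hu : B u u = 0) : u = 0 := by
  by_contra h
  have := hBpos u h
  rw [hu, Complex.zero_re] at this
  exact lt_irrefl _ this

variable [NonarchimedeanGroup G] [LocallyCompactSpace G] [T2Space G]

/-- **Riesz representation for an admissible irreducible representation with an invariant definite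
form.** Let `ρ` be irreducible and admissible (locally profinite `G`), and `B` a `G`-invariant
sesquilinear form with `B u u = 0 → u = 0`. Then every smooth linear form `f ∈ Ṽ` is `B v` for a
(unique, `eq_of_sesqForm_apply_eq`) vector `v`: the image `{B v}` of `V` is a non-zero
subrepresentation of the contragredient `Ṽ`, which is irreducible
(`Representation.isIrreducible_contragredient_holds`, Bernstein–Zelevinsky 1976, Prop. 2.15), so it is
everything. In other words `v ↦ B v` is a conjugate-linear `G`-isomorphism `V ≃ Ṽ`
(Bushnell–Henniart 2006, §2.8–2.10; Bernstein–Zelevinsky 1976, Prop. 2.14–2.15). [cite: Laumon1995, Lemma (D.6.3) (i)] -/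
theorem exists_sesqForm_apply_eq_of_mem_contragredient [ρ.IsIrreducible] (hadm : ρ.IsAdmissible)
    {B : V →ₗ⋆[ℂ] V →ₗ[ℂ] ℂ} (hBinv : ∀ (g : G) (v w : V), B (ρ g v) (ρ g w) = B v w)
    (hBdef : ∀ u : V, B u u = 0 → u = 0) {f : Module.Dual ℂ V} (hf : f ∈ ρ.contragredient) :
    ∃ v : V, B v = f := by
  haveI hirr : ρ.contragredientRep.IsIrreducible := isIrreducible_contragredient_holds ρ hadm
  haveI : Nontrivial V := IsIrreducible.nontrivial ρ
  have hmem : ∀ v : V, (B v : Module.Dual ℂ V) ∈ ρ.contragredient :=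
    sesqForm_apply_mem_contragredient hadm.isSmooth B hBinv
  -- the image of `B` as a subrepresentation of `Ṽ`
  let W : Subrepresentation ρ.contragredientRep :=
    ⟨{ carrier := {φ | ∃ v : V, Contragredient.subtype ρ φ = B v}
       add_mem' := by
         rintro φ ψ ⟨v, hv⟩ ⟨w, hw⟩
         exact ⟨v + w, by rw [map_add, hv, hw, map_add]⟩
       zero_mem' := ⟨0, by rw [map_zero, map_zero]⟩
       smul_mem' := by
         rintro z φ ⟨v, hv⟩
         refine ⟨(starRingEnd ℂ z) • v, ?_⟩
         rw [map_smul, hv, LinearMap.map_smulₛₗ, starRingEnd_self_apply] },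
     by
       rintro g φ ⟨v, hv⟩
       refine ⟨ρ g v, LinearMap.ext fun a => ?_⟩
       rw [subtype_contragredientRep_apply, hv]
       simp only [dual_apply, Module.Dual.transpose_apply, LinearMap.comp_apply]
       calc B v (ρ g⁻¹ a) = B (ρ g v) (ρ g (ρ g⁻¹ a)) := (hBinv g _ _).symm
         _ = B (ρ g v) a := by rw [self_inv_apply]⟩
  -- `W ≠ ⊥`
  obtain ⟨v₀, hv₀⟩ := exists_ne (0 : V)
  have hBv₀ : (B v₀ : Module.Dual ℂ V) ≠ 0 := fun h0 =>
    hv₀ (hBdef v₀ (by rw [h0, LinearMap.zero_apply]))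
  let F₀ : ρ.Contragredient := ⟨B v₀, hmem v₀⟩
  have hF₀W : F₀ ∈ W := ⟨v₀, rfl⟩
  have hW : W ≠ ⊥ := by
    intro h
    rw [h, Subrepresentation.mem_bot_iff] at hF₀W
    exact hBv₀ (congrArg (Contragredient.subtype ρ) hF₀W)
  have hWtop : W = ⊤ := (eq_bot_or_eq_top W).resolve_left hW
  -- read off the preimage of `f`
  let F : ρ.Contragredient := ⟨f, hf⟩
  have hF : F ∈ W := hWtop ▸ Subrepresentation.mem_top' F
  obtain ⟨v, hv⟩ := hF
  exact ⟨v, hv.symm⟩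

/-- **Schur's lemma for invariant sesquilinear forms.** On an irreducible admissible representation
`ρ` of a locally profinite group carrying a `G`-invariant definite sesquilinear form `B`, every
`G`-invariant sesquilinear form `T` is a scalar multiple of `B`: `T v w = λ • B v w`. Proof: by
Riesz (`exists_sesqForm_apply_eq_of_mem_contragredient`) `T c = B (A c)` for a unique `A c`; `A` is
a linear `G`-map, hence a scalar `μ` by Schur's lemma for admissible representations
(`Representation.IsAdmissible.exists_eq_smul_id`), and `λ = conj μ`.
(the form-version of Bump 1997, Prop. 4.2.4). [cite: Laumon1995, Lemma (D.6.3) (ii)] -/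
theorem exists_sesqForm_eq_smul [ρ.IsIrreducible] (hadm : ρ.IsAdmissible)
    {B : V →ₗ⋆[ℂ] V →ₗ[ℂ] ℂ} (hBinv : ∀ (g : G) (v w : V), B (ρ g v) (ρ g w) = B v w)
    (hBdef : ∀ u : V, B u u = 0 → u = 0)
    (T : V →ₗ⋆[ℂ] V →ₗ[ℂ] ℂ) (hT : ∀ (g : G) (v w : V), T (ρ g v) (ρ g w) = T v w) :
    ∃ c₀ : ℂ, ∀ v w : V, T v w = c₀ * B v w := by
  obtain ⟨K₀, hK₀c⟩ := exists_isCompact_openSubgroup (G := G)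
  have hex : ∀ c : V, ∃ u : V, B u = T c := fun c =>
    exists_sesqForm_apply_eq_of_mem_contragredient hadm hBinv hBdef
      (sesqForm_apply_mem_contragredient hadm.isSmooth T hT c)
  choose A hA using hex
  have hAadd : ∀ c c' : V, A (c + c') = A c + A c' := fun c c' =>
    eq_of_sesqForm_apply_eq hBdef (by rw [hA, map_add, map_add, hA, hA])
  have hAsmul : ∀ (z : ℂ) (c : V), A (z • c) = z • A c := fun z c =>
    eq_of_sesqForm_apply_eq hBdef (by
      rw [hA, LinearMap.map_smulₛₗ, LinearMap.map_smulₛₗ, hA])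
  let A' : V →ₗ[ℂ] V := { toFun := A, map_add' := hAadd, map_smul' := hAsmul }
  have hA'G : ∀ g : G, A' ∘ₗ ρ g = ρ g ∘ₗ A' := by
    intro g
    refine LinearMap.ext fun c => ?_
    simp only [LinearMap.comp_apply, LinearMap.coe_mk, AddHom.coe_mk, A']
    refine eq_of_sesqForm_apply_eq hBdef (LinearMap.ext fun a => ?_)
    rw [hA]
    calc T (ρ g c) a = T (ρ g⁻¹ (ρ g c)) (ρ g⁻¹ a) := (hT g⁻¹ _ _).symm
      _ = T c (ρ g⁻¹ a) := by rw [inv_self_apply]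
      _ = B (A c) (ρ g⁻¹ a) := by rw [← hA]
      _ = B (ρ g (A c)) (ρ g (ρ g⁻¹ a)) := (hBinv g _ _).symm
      _ = B (ρ g (A c)) a := by rw [self_inv_apply]
  obtain ⟨μ, hμ⟩ := hadm.exists_eq_smul_id K₀.isOpen hK₀c A' hA'G
  refine ⟨conj μ, fun v w => ?_⟩
  have h1 : T v w = B (A v) w := by rw [hA]
  have h2 : A v = μ • v := by
    simpa [A'] using LinearMap.congr_fun hμ v
  rw [h1, h2, LinearMap.map_smulₛₗ, LinearMap.smul_apply, smul_eq_mul]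

end Algebra

/-! ### Matrix coefficients `x ↦ B w (ρ x v)`: continuity and compact support -/

section Coefficients

variable {G V : Type*} [Group G] [TopologicalSpace G] [AddCommGroup V] [Module ℂ V]
  {ρ : Representation ℂ G V} {B : V →ₗ⋆[ℂ] V →ₗ[ℂ] ℂ}

/-- The coefficient `x ↦ B w (ρ x v)` — the matrix coefficient `c_{B w, v}` — of a smooth vector `v`
is continuous (locally constant, `Representation.continuous_matrixCoeff`). [cite: Laumon1995, (D.6), proof of Lemma (D.6.4) («a locally constant function on H»)] -/
theorem continuous_sesqForm_apply_apply [SeparatelyContinuousMul G] {v : V}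
    (hv : ρ.IsSmoothVector v) (w : V) : Continuous fun x => B w (ρ x v) :=
  ρ.continuous_matrixCoeff (B w) hv

/-- The coefficient `x ↦ B (ρ x v) w = conj (B w (ρ x v))` of a smooth vector `v` is continuous, for
`B` Hermitian. [cite: Laumon1995, (D.6), proof of Lemma (D.6.4)] -/
theorem continuous_sesqForm_apply_apply' [SeparatelyContinuousMul G] (hBsymm : B.IsSymm) {v : V}
    (hv : ρ.IsSmoothVector v) (w : V) : Continuous fun x => B (ρ x v) w := by
  have h : (fun x => B (ρ x v) w) = fun x => conj (B w (ρ x v)) :=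
    funext fun x => (hBsymm.eq w (ρ x v)).symm
  rw [h]
  exact Complex.continuous_conj.comp (continuous_sesqForm_apply_apply hv w)

variable [IsTopologicalGroup G]

/-- **Compact centre ⇒ compactly supported coefficients.** For a supercuspidal representation of a
group with compact centre, every smooth matrix coefficient `c_{φ,v}` (`φ ∈ Ṽ`) has compact support
ON `G`: `supp c_{φ,v} ⊆ C · Z(G)` with `C` and `Z(G)` compact (Harish-Chandra 1970, Part I §3;
Rogawski 1990, p. 187, for `U(3)` whose centre `E¹` is compact). [cite: HarishChandra1970, Part I §3 p. 9 (supercusp forms: Supp f ⊂ C_f · Z)] -/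
theorem IsSupercuspidal.hasCompactSupport_matrixCoeff (hsc : ρ.IsSupercuspidal)
    (hZ : IsCompact (Subgroup.center G : Set G)) {φ : Module.Dual ℂ V}
    (hφ : φ ∈ ρ.contragredient) (v : V) : HasCompactSupport (ρ.matrixCoeff φ v) := by
  obtain ⟨C, hC, hsupp⟩ := hsc φ hφ v
  exact HasCompactSupport.of_support_subset_isCompact (hC.mul hZ) hsupp

/-- For `B` a `G`-invariant sesquilinear form on a smooth supercuspidal representation of a group with
compact centre, the coefficient `x ↦ B w (ρ x v)` has compact support (`B w ∈ Ṽ` by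
`sesqForm_apply_mem_contragredient`). [cite: HarishChandra1970, Part I §3 p. 9] -/
theorem IsSupercuspidal.hasCompactSupport_sesqForm_apply_apply (hsc : ρ.IsSupercuspidal)
    (hZ : IsCompact (Subgroup.center G : Set G)) (hsm : ρ.IsSmooth)
    (hBinv : ∀ (g : G) (v w : V), B (ρ g v) (ρ g w) = B v w) (v w : V) :
    HasCompactSupport fun x => B w (ρ x v) :=
  hsc.hasCompactSupport_matrixCoeff hZ (sesqForm_apply_mem_contragredient hsm B hBinv w) v

/-- The coefficient `x ↦ B (ρ x v) w = B v (ρ x⁻¹ w)` has compact support as well (inversion is a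
homeomorphism). [cite: HarishChandra1970, Part I §3 p. 9] -/
theorem IsSupercuspidal.hasCompactSupport_sesqForm_apply_apply' (hsc : ρ.IsSupercuspidal)
    (hZ : IsCompact (Subgroup.center G : Set G)) (hsm : ρ.IsSmooth)
    (hBinv : ∀ (g : G) (v w : V), B (ρ g v) (ρ g w) = B v w) (v w : V) :
    HasCompactSupport fun x => B (ρ x v) w := by
  have h : (fun x => B (ρ x v) w) = (fun y => B v (ρ y w)) ∘ (Homeomorph.inv G) := by
    funext x
    simp only [Function.comp_apply, Homeomorph.coe_inv]
    rw [← hBinv x⁻¹ (ρ x v) w, inv_self_apply]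
  rw [h]
  exact (hsc.hasCompactSupport_sesqForm_apply_apply hZ hsm hBinv w v).comp_homeomorph _

end Coefficients

end Representation
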